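import Literature.NumberTheory.EllipticCurves.ZpExtensionEisensteinReadoutOrdinaryStrictProofs
import Literature.NumberTheory.EllipticCurves.ZpExtensionEisensteinOrdinaryCoboundaryShiftProofs
import Literature.NumberTheory.EllipticCurves.ZpExtensionEisensteinReadoutUnramifiedConverseProofs
import Literature.NumberTheory.EllipticCurves.IwasawaSelmerProofs
import Literature.NumberTheory.EllipticCurves.ZpExtensionEisensteinAdicTowerIncReadoutProofs
import Literature.NumberTheory.EllipticCurves.ZpExtensionScalarTwistFiniteProofs
import Literature.NumberTheory.GaloisCohomology.Howard2004.TowerMorphism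
import HarnessLib

/-!
# hS′ at `v ∣ p`: readout-Selmer classes are gr-principal on `Gal(K̄_v/K_{∞,w})` after a bounded level shift
# (proofs file; input of the letter `Stmt.readoutLocalIndexP` of the shared μ-crux, stmt-BirchSwinnertonDyer-23428)

Topic `NumberTheory/EllipticCurves` (cell `pub/bsd-print-x9`; sequel to `ZpExtensionEisensteinOrdinaryCoboundaryShiftProofs`
(the uniform shift exponent), `ZpExtensionEisensteinReadoutOrdinaryStrictProofs` / `Greenberg1999/KummerImageGoodOrdinaryNumberField`
((CG): Kummer = strict over `K_{∞,w}`), `ZpExtensionEisensteinReadoutUnramifiedConverseProofs` (all coordinate classes follow the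
last one into a `conj_γ`-stable subgroup) and `ZpExtensionEisensteinAdicTowerIncReadoutProofs` (`inc ∘ red = −p`)).
THEOREMS ONLY: no definition, no named fact, no instance, no `sorry`.

* §1 `eisensteinTower_inc_tmul_mk` — `inc_k([f] ⊗ P) = −([f] ⊗ P)` (`P ∈ E[p^{k+1}] ⊆ E[p^{k+2}]`).
* §2 `exists_cocycle_incLocIter_localization` — a cocycle of `incLocIter … d (loc_v c)` with values
  `(−1)^d ∑_i [T^i] ⊗ φ_i(res σ)` on the elements restricting into `Gal(K̄/K_∞)`.
* §3 `exists_grMk_eq_coboundary_of_mem_localKerOver` — (CG) backwards on cocycles: a coordinate class in the local condition of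
  `Sel_{p^∞}(E/K_∞)` at `v ∣ p` is a coboundary modulo `C_v` on `ker κ ⊓ D_v`.
* §4 **`exists_quotient_cocycle_principal_of_eisensteinTowerReadout_mem_selmerInfty`** — `∃ d ∀ k c`: if the readout of
  `c ∈ H¹(K, T^{(k)})` lies in `Sel_{p^∞}(E/K_∞)` then the image of `incLocIter … d (loc_v c)` modulo `Fil_v` has a cocycle
  equal to `σ ↦ σ q₀ − q₀` on `{σ : res σ ∈ ker κ}` — the membership predicate of the (B5) owner's relaxed condition at
  level `k + d` (x10b-p1-w7's `exists_addSubgroup_gradedPrincipal`), i.e. the first conjunct of `Stmt.readoutLocalIndexP` for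
  `Fv := F′.comap (incLocIter … d)`.

References: [Howard2004HeegnerKolyvagin] Lemma 2.2.7 / Prop. 2.2.8, proof of Thm. 2.2.10 (arXiv:1202.6340 p. 17 L41–53), §1.6,
§3.1; [GreenbergLNM1716] §2 Prop. 2.2, Prop. 2.4 (pp. 73–80), §4 pp. 107, 124; [Greenberg1989] §1 p. 98.
BSD is not proved by any of this.
-/

noncomputable section

open scoped Classical ContRepresentation

open NumberField IsDedekindDomain Field
open Literature.NumberTheory.EllipticCurves Literature.NumberTheory.GaloisRepresentations
open Literature.NumberTheory.GaloisRepresentations.galoisCohomology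
open Literature.NumberTheory.GaloisCohomology.Howard2004
open Literature.NumberTheory.EllipticCurves.GreenbergSelmer
open IwasawaAlgebra IwasawaAlgebra.EisensteinCoeff

namespace WeierstrassCurve

open Literature.NumberTheory.EllipticCurves.ZpExtension (EisensteinLevel)

variable {K : Type} [Field K] [NumberField K] (W : WeierstrassCurve ℚ) [W.IsElliptic] {p : ℕ} [hp : Fact p.Prime]
  (κ : ZpExtension K p) {m : ℕ} (hm : 1 ≤ m)

variable (π : IwasawaAlgebra p ⧸ Ideal.span {(PowerSeries.X ^ m + PowerSeries.C (p : ℤ_[p]) : IwasawaAlgebra p)})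
  (e : ℕ → ℕ)
  (hkill : letI := IwasawaAlgebra.isLocalRing_quotient_X_pow_add_C p hm
    ∀ k, ∀ r ∈ IsLocalRing.maximalIdeal
      (IwasawaAlgebra p ⧸ Ideal.span {(PowerSeries.X ^ m + PowerSeries.C (p : ℤ_[p]) : IwasawaAlgebra p)}) ^ e k,
      ∀ x : EisensteinLevel p m (fun j ↦ geomTorsion (W.baseChange K) ((p : ℤ) ^ j)) (k + 1), r • x = 0)
  (hker : letI := IwasawaAlgebra.isLocalRing_quotient_X_pow_add_C p hm
    ∀ k, LinearMap.ker ((W.eisensteinTower (κ.unitTwist (-1)) hm).red k) =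
      (IsLocalRing.maximalIdeal
        (IwasawaAlgebra p ⧸ Ideal.span {(PowerSeries.X ^ m + PowerSeries.C (p : ℤ_[p]) : IwasawaAlgebra p)}) ^ e k) •
        (⊤ : Submodule (IwasawaAlgebra p ⧸ Ideal.span {(PowerSeries.X ^ m + PowerSeries.C (p : ℤ_[p]) : IwasawaAlgebra p)})
          (EisensteinLevel p m (fun j ↦ geomTorsion (W.baseChange K) ((p : ℤ) ^ j)) (k + 1 + 1))))
  (hπ : letI := IwasawaAlgebra.isLocalRing_quotient_X_pow_add_C p hm
    π ∈ IsLocalRing.maximalIdeal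
      (IwasawaAlgebra p ⧸ Ideal.span {(PowerSeries.X ^ m + PowerSeries.C (p : ℤ_[p]) : IwasawaAlgebra p)}))
  (he : ∀ k, e k ≤ e (k + 1))
  (hπX : π = Ideal.Quotient.mk _ PowerSeries.X) (hek : ∀ k, e (k + 1) - e k = m)

/-! ## §1 The transition map `inc` of Howard's tower on pure tensors -/

include hπX hek in
/-- **`inc_k ([f] ⊗ P) = −([f] ⊗ P)`** with `P ∈ E[p^{k+1}]` viewed in `E[p^{k+2}]` on the right: the transition map of
`A_𝔮 = colim_k T_𝔮/p^{k+1}T_𝔮` is multiplication by `π^m = −p` on a lift (`inc_k ∘ red_k = −p`), and `−p · ([f] ⊗ P̃) =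
−([f] ⊗ p P̃)` for a `p`-division point `P̃` of `P`. [cite: Howard2004HeegnerKolyvagin, §1.6 (arXiv p. 12, L40–48) and §2.2, proof of Thm. 2.2.10 (𝔮 = T^m + p)] -/
theorem eisensteinTower_inc_tmul_mk (k : ℕ) (f : IwasawaAlgebra p)
    (P : geomTorsion (W.baseChange K) ((p : ℤ) ^ (k + 1))) :
    letI := IwasawaAlgebra.isLocalRing_quotient_X_pow_add_C p hm
    (AdicTower.inc (W.eisensteinTower (κ.unitTwist (-1)) hm) π e hkill hker hπ he k
        (Twisted.tmul (Ideal.Quotient.mk _ f : EisensteinCoeff p m (k + 1)) P :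
          EisensteinLevel p m (fun j ↦ geomTorsion (W.baseChange K) ((p : ℤ) ^ j)) (k + 1)) :
        Twisted p m (k + 1 + 1) (geomTorsion (W.baseChange K) ((p : ℤ) ^ (k + 1 + 1)))) =
      -Twisted.tmul (Ideal.Quotient.mk _ f : EisensteinCoeff p m (k + 1 + 1))
        (AddSubgroup.inclusion (geomTorsion_le_of_dvd (W.baseChange K) (pow_dvd_pow (p : ℤ) (Nat.le_succ (k + 1)))) P) := by
  letI := IwasawaAlgebra.isLocalRing_quotient_X_pow_add_C p hm
  obtain ⟨Q, hQ⟩ := (W.baseChange K).torsionGaloisModuleReduce_surjective p (k + 1) P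
  have hred : (W.eisensteinTower (κ.unitTwist (-1)) hm).red k
      (Twisted.tmul (Ideal.Quotient.mk _ f : EisensteinCoeff p m (k + 1 + 1)) Q :
        EisensteinLevel p m (fun j ↦ geomTorsion (W.baseChange K) ((p : ℤ) ^ j)) (k + 1 + 1)) =
      (Twisted.tmul (Ideal.Quotient.mk _ f : EisensteinCoeff p m (k + 1)) P :
          EisensteinLevel p m (fun j ↦ geomTorsion (W.baseChange K) ((p : ℤ) ^ j)) (k + 1)) := by
    change (κ.unitTwist (-1)).eisensteinTwistReduce hm (Nat.le_succ (k + 1))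
      ((W.baseChange K).torsionGaloisModuleReduce p (k + 1)) (Twisted.tmul _ Q) = _
    rw [ZpExtension.eisensteinTwistReduce_tmul, EisensteinCoeff.reduce_mk, ← hQ]
  rw [← hred]
  have hinc := (κ.unitTwist (-1)).eisensteinAdicTowerSucc_inc_red
    (fun j ↦ (W.baseChange K).torsionGaloisModule ((p : ℤ) ^ j)) (fun j ↦ (W.baseChange K).torsionGaloisModuleReduce p j)
    hm (fun j ↦ (W.baseChange K).torsionGaloisModuleReduce_surjective p j) k π e hkill hker hπ he hπX (hek k)
    (Twisted.tmul (Ideal.Quotient.mk _ f : EisensteinCoeff p m (k + 1 + 1)) Q :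
        EisensteinLevel p m (fun j ↦ geomTorsion (W.baseChange K) ((p : ℤ) ^ j)) (k + 1 + 1))
  change AdicTower.inc (W.eisensteinTower (κ.unitTwist (-1)) hm) π e hkill hker hπ he k
    ((W.eisensteinTower (κ.unitTwist (-1)) hm).red k _) = _ at hinc
  rw [hinc, ← hQ, (W.baseChange K).torsionIncl_torsionGaloisModuleReduce p k Q, Twisted.tmul_nsmul]
  rfl

/-! ## §2 A cocycle for `incLocIter … d (loc_v c)` whose values on `Gal(K̄_v/K_{∞,w})` are read off the coordinate
cocycles of `c` -/

include hπX hek in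
/-- **An explicit cocycle of the `d`-fold pushed-up localisation.** For a cocycle `ξ` of `c ∈ H¹(K, T^{(k)})`
(`T^{(k)} = E[p^{k+1}] ⊗ A_{m,k+1}(ψ⁻¹)`) with coordinate cocycles `φ_i` on `Gal(K̄/K_∞)` (`exists_coordCocycles`) and
every `d`, there is a cocycle `η` of `incLocIter … d (loc_v c) ∈ H¹(K_v, T^{(k+d)})` with
`η(σ) = (−1)^d · ∑_i [T^i] ⊗ φ_i(res σ)` (coordinates included into `E[p^{k+d+1}]`) for every `σ ∈ Γ_{K_v}` restricting
into `Gal(K̄/K_∞)` (`ξ(h) = ∑_i [T^i] ⊗ φ_i(h)`; `inc` is `−1` on such sums, §1).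
[cite: Howard2004HeegnerKolyvagin, §1.6 (arXiv p. 11 L18–20, p. 12 L40–48) and §2.2] [cite: SerreGaloisCohomology1997, Ch. I §2.4] -/
theorem exists_cocycle_incLocIter_localization (v : HeightOneSpectrum (𝓞 K)) (k : ℕ)
    (ξ : contOneCocycles
      ((κ.unitTwist (-1)).eisensteinTwist ((W.baseChange K).torsionGaloisModule ((p : ℤ) ^ (k + 1))) hm (k + 1)).toTopRep)
    (φ : Fin m → contOneCocycles (discreteTopRep κ.kerSubgroup (geomTorsion (W.baseChange K) ((p : ℤ) ^ (k + 1)))))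
    (hφ : ∀ (j : Fin m) (h : κ.kerSubgroup), (φ j).1 h =
      Twisted.tailReadout p hm (k + 1) ((W.baseChange K).geomTorsion_pow_nsmul_eq_zero p (k + 1))
        (EisensteinCoeff.dualFamily p hm (k + 1) j • ξ.1 (h : absoluteGaloisGroup K)))
    (d : ℕ) :
    letI := IwasawaAlgebra.isLocalRing_quotient_X_pow_add_C p hm
    ∃ η : contOneCocycles (((W.eisensteinTower (κ.unitTwist (-1)) hm).ρ (k + d)).toLocal (Sum.inr v : Place K)).toTopRep,
      oneCocycleClass _ η =
        AdicTower.incLocIter (W.eisensteinTower (κ.unitTwist (-1)) hm) π e hkill hker hπ he k (Sum.inr v) d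
          (galoisCohomology.localization
            ((κ.unitTwist (-1)).eisensteinTwist ((W.baseChange K).torsionGaloisModule ((p : ℤ) ^ (k + 1))) hm (k + 1))
            (Sum.inr v) 1 (oneCocycleClass _ ξ)) ∧
      ∀ (σ : absoluteGaloisGroup (v.adicCompletion K))
        (hσ : absGaloisRestrict K (v.adicCompletion K) σ ∈ κ.kerSubgroup),
        (η.1 σ : Twisted p m (k + d + 1) (geomTorsion (W.baseChange K) ((p : ℤ) ^ (k + d + 1)))) =
          ((-1 : ℤ) ^ d) • ∑ i : Fin m, Twisted.tmul
            (Ideal.Quotient.mk _ ((PowerSeries.X : IwasawaAlgebra p) ^ (i : ℕ)) : EisensteinCoeff p m (k + d + 1))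
            (AddSubgroup.inclusion (geomTorsion_le_of_dvd (W.baseChange K)
              (pow_dvd_pow (p : ℤ) (Nat.add_le_add_right (Nat.le_add_right k d) 1)))
              ((φ i).1 ⟨absGaloisRestrict K (v.adicCompletion K) σ, hσ⟩)) := by
  letI := IwasawaAlgebra.isLocalRing_quotient_X_pow_add_C p hm
  induction d with
  | zero =>
    refine ⟨contOneCocycles.pullback (absGaloisRestrict K (Place.Completion (Sum.inr v : Place K)))
      (X := ((κ.unitTwist (-1)).eisensteinTwist ((W.baseChange K).torsionGaloisModule ((p : ℤ) ^ (k + 1))) hm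
        (k + 1)).toTopRep)
      (Y := (((κ.unitTwist (-1)).eisensteinTwist ((W.baseChange K).torsionGaloisModule ((p : ℤ) ^ (k + 1))) hm
        (k + 1)).toLocal (Sum.inr v : Place K)).toTopRep)
      (TopRep.ofHom ⟨ContinuousLinearMap.id ℤ _, fun _ ↦ rfl⟩) ξ,
      (galoisCohomology.pullback_one_oneCocycleClass _ _ ξ).symm, fun σ hσ ↦ ?_⟩
    rw [pow_zero, one_smul]
    change ξ.1 (absGaloisRestrict K (v.adicCompletion K) σ) = _
    conv_lhs => rw [Twisted.eq_sum_tmul_tailReadout p hm (k + 1)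
      ((W.baseChange K).geomTorsion_pow_nsmul_eq_zero p (k + 1)) (ξ.1 (absGaloisRestrict K (v.adicCompletion K) σ))]
    exact Finset.sum_congr rfl fun i _ ↦ by rw [hφ i ⟨_, hσ⟩]; rfl
  | succ d ih =>
    obtain ⟨η, hη, hηval⟩ := ih
    refine ⟨contOneCocycles.pullback (ContinuousMonoidHom.id _)
      (X := (((W.eisensteinTower (κ.unitTwist (-1)) hm).ρ (k + d)).toLocal (Sum.inr v : Place K)).toTopRep)
      (Y := (((W.eisensteinTower (κ.unitTwist (-1)) hm).ρ (k + d + 1)).toLocal (Sum.inr v : Place K)).toTopRep)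
      (TopRep.ofHom ⟨⟨(AdicTower.inc (W.eisensteinTower (κ.unitTwist (-1)) hm) π e hkill hker hπ he
          (k + d)).toAddMonoidHom.toIntLinearMap, continuous_of_discreteTopology⟩,
        fun g => ContinuousLinearMap.ext fun x =>
          AdicTower.inc_equivariant (W.eisensteinTower (κ.unitTwist (-1)) hm) π e hkill hker hπ he (k + d) _ x⟩) η,
      ?_, fun σ hσ ↦ ?_⟩
    · change _ = AdicTower.incLoc (W.eisensteinTower (κ.unitTwist (-1)) hm) π e hkill hker hπ he (k + d) (Sum.inr v)
        (AdicTower.incLocIter (W.eisensteinTower (κ.unitTwist (-1)) hm) π e hkill hker hπ he k (Sum.inr v) d _)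
      rw [← hη]
      exact (map_oneCocycleClass _ _ _ η).symm
    · have hval := hηval σ hσ
      let ι : Twisted p m (k + d + 1) (geomTorsion (W.baseChange K) ((p : ℤ) ^ (k + d + 1))) →+
          Twisted p m (k + d + 1 + 1) (geomTorsion (W.baseChange K) ((p : ℤ) ^ (k + d + 1 + 1))) :=
        (AdicTower.inc (W.eisensteinTower (κ.unitTwist (-1)) hm) π e hkill hker hπ he (k + d)).toAddMonoidHom
      change ι (η.1 σ : Twisted p m (k + d + 1) (geomTorsion (W.baseChange K) ((p : ℤ) ^ (k + d + 1)))) = _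
      rw [hval, map_zsmul, map_sum, pow_succ (-1 : ℤ) d, mul_neg_one, neg_smul, ← smul_neg, ← Finset.sum_neg_distrib]
      congr 1
      exact Finset.sum_congr rfl fun i _ ↦
        W.eisensteinTower_inc_tmul_mk κ hm π e hkill hker hπ he hπX hek (k + d) _ _

/-! ## §3 A coordinate class in the local condition of `Sel_{p^∞}(E/K_∞)` at `v ∣ p` is a coboundary MODULO `C_v` on
`ker κ ⊓ D_v` (Greenberg's Prop. 2.4, the cite-only leaf (CG), read backwards) -/

/-- **Kummer classes over `K_{∞,w}` are strict modulo `C_v`, on cocycles.** At a place `v ∣ p` of good ordinary reduction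
ramified in `K_∞`, granted (CG) (`hCG`): if the class `ι_*[φ] ∈ H¹(K_∞, E[p^∞])` of a cocycle `φ` of `Gal(K̄/K_∞)` in `E[p^k]`
lies in the local condition of `Sel_{p^∞}(E/K_∞)` at the place above `v`, then modulo `C_v = E[p^∞] ∩ E₁(K̄_v)` the cocycle is a
coboundary on `ker κ ⊓ D_v`: `φ(y) ≡ y • q − q (mod C_v)` for some `q ∈ E[p^∞]/C_v`.
[cite: GreenbergLNM1716, §2 Prop. 2.2 and Prop. 2.4 (pp. 73–80)] [cite: Greenberg1989, §1 p. 98 (strict condition)] -/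
theorem exists_grMk_eq_coboundary_of_mem_localKerOver (V : WeierstrassCurve K) [V.IsElliptic] (v : HeightOneSpectrum (𝓞 K))
    (hpv : ((p : ℕ) : 𝓞 K) ∈ v.asIdeal) (hgood : V.HasGoodReductionAt v) (hord : V.HasUnitRootAt v)
    (hram : ∃ 𝔓 ∈ v.primesAbove, ¬ 𝔓.inertia (absoluteGaloisGroup K) ≤ κ.kerSubgroup)
    (hCG : Greenberg1999.imKummer_eq_strictCondition_goodOrdinary_numberField) {k : ℕ}
    (φ : contOneCocycles (discreteTopRep κ.kerSubgroup (geomTorsion V ((p : ℤ) ^ k))))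
    (hφ : resH1Hom (ContinuousMonoidHom.id κ.kerSubgroup)
        (AddSubgroup.inclusion (AcSigned.geomTorsion_zpow_le_geomPrimaryTorsion V p k)) (fun _ _ ↦ rfl)
        (oneCocycleClass _ φ) ∈ V.localKerOver p κ.kerSubgroup (v.adicCompletion K)) :
    ∃ q : (V.kernelOfReductionLocalDatum p v).Gr, ∀ y : decompIn κ.kerSubgroup v,
      (V.kernelOfReductionLocalDatum p v).grMk
          (AddSubgroup.inclusion (AcSigned.geomTorsion_zpow_le_geomPrimaryTorsion V p k)
            (φ.1 (decompInToH κ.kerSubgroup v y))) = y • q - q := by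
  have h := (Greenberg1999.imKummer_eq_strictCondition_goodOrdinary_numberField.kerSubgroup_kernelOfReduction V p v hpv
    hgood hord κ hram hCG).le hφ
  rw [LocalDatum.mem_strictKer_iff] at h
  change resH1Hom (decompInToH κ.kerSubgroup v) (V.kernelOfReductionLocalDatum p v).grMk (fun _ _ ↦ rfl)
    (resH1Hom (ContinuousMonoidHom.id κ.kerSubgroup)
      (AddSubgroup.inclusion (AcSigned.geomTorsion_zpow_le_geomPrimaryTorsion V p k)) (fun _ _ ↦ rfl)
      (oneCocycleClass _ φ)) = 0 at h
  rw [← AddMonoidHom.comp_apply, resH1Hom_comp, CocycleCriteria.resH1Hom_oneCocycleClass_eq_zero_iff] at h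
  obtain ⟨q, hq⟩ := h
  exact ⟨q, fun y ↦ hq y⟩

/-! ## §4 hS′ at `v ∣ p`: the readout-Selmer classes satisfy the level-shifted «gr-principal on `Gal(K̄_v/K_{∞,w})`»
condition -/

set_option maxHeartbeats 1600000 in -- statement-size unification of the letter shapes (as DG4's)
include hπX hek in
/-- **hS′ at `v ∣ p` (input of the letter `Stmt.readoutLocalIndexP` of the shared μ-crux, in the (B5) owner's level-shifted
currency).**  Let `E = W_K`, `γ` a topological generator of `κ`, `v ∣ p` a place of good ordinary reduction (with an ordinary
point) ramified in `K_∞`, and grant (CG) (`hCG`).  There is `d : ℕ` — depending on `E`, `v`, `κ` only — such that for every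
level `k` and every class `c ∈ H¹(K, T^{(k)})` (`T^{(k)} = E[p^{k+1}] ⊗ A_{m,k+1}(ψ⁻¹)`) whose readout lies in `Sel_{p^∞}(E/K_∞)`:
the image of `incLocIter … d (loc_v c) ∈ H¹(K_v, T^{(k+d)})` in `H¹(K_v, T^{(k+d)}/Fil_v)` has a cocycle which is an honest
coboundary `σ ↦ σ·q₀ − q₀` on the elements of `Γ_{K_v}` restricting into `Gal(K̄/K_∞)`.  (All coordinate classes lie in
`Sel_{p^∞}` (shift relations), hence — Kummer ⇒ strict, (CG) — are coboundaries modulo `C_v` on `ker κ ⊓ D_v` of classes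
`q_i ∈ E[p^∞]/C_v`; the shift lemma moves the `q_i` into `E[p^{k+d+1}]`; `inc` is `−1` on coordinates.)
[cite: Howard2004HeegnerKolyvagin, Lemma 2.2.7 / Prop. 2.2.8 (second map) and proof of Thm. 2.2.10 (arXiv p. 17 L41–53)]
[cite: GreenbergLNM1716, §2 Prop. 2.2, Prop. 2.4 (pp. 73–80) and §4 pp. 107, 124] -/
theorem exists_quotient_cocycle_principal_of_eisensteinTowerReadout_mem_selmerInfty {γ : absoluteGaloisGroup K}
    (hγ : κ.IsTopGenerator γ) (v : HeightOneSpectrum (𝓞 K)) (hpv : ((p : ℕ) : 𝓞 K) ∈ v.asIdeal)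
    (hgood : (W.baseChange K).HasGoodReductionAt v) (hord : (W.baseChange K).HasUnitRootAt v)
    (hord' : ∃ P : localPoints (W.baseChange K) (v.adicCompletion K),
      (p : ℤ) • P = 0 ∧ P ∉ (W.baseChange K).localKernelOfReduction v)
    (hram : ∃ 𝔓 ∈ v.primesAbove, ¬ 𝔓.inertia (absoluteGaloisGroup K) ≤ κ.kerSubgroup)
    (hCG : Greenberg1999.imKummer_eq_strictCondition_goodOrdinary_numberField) :
    letI := IwasawaAlgebra.isLocalRing_quotient_X_pow_add_C p hm
    ∃ d : ℕ, ∀ (k : ℕ) (c : galoisCohomology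
        ((κ.unitTwist (-1)).eisensteinTwist ((W.baseChange K).torsionGaloisModule ((p : ℤ) ^ (k + 1))) hm (k + 1)) 1),
      W.eisensteinTowerReadout κ hm π e hkill hker hπ he hπX hek
          (AddCommGroup.DirectLimit.of _ _ k c :
            AdicTower.H1A (W.eisensteinTower (κ.unitTwist (-1)) hm) π e hkill hker hπ he) ∈
        (W.baseChange K).selmerInfty κ →
      ∃ φq : contOneCocycles ((GaloisRep.toLocal v ((κ.unitTwist (-1)).eisensteinTwist
          ((W.baseChange K).torsionGaloisModule ((p : ℤ) ^ (k + d + 1))) hm (k + d + 1))).quotient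
          (((W.baseChange K).ordinaryFiltrationAt v (fun i ↦ (W.baseChange K).torsionGaloisModuleReduce p i)
            (fun _ _ ↦ rfl)).twistedFil (k + d + 1))
          (((W.baseChange K).ordinaryFiltrationAt v (fun i ↦ (W.baseChange K).torsionGaloisModuleReduce p i)
            (fun _ _ ↦ rfl)).twistedFil_le_comap (κ := κ.unitTwist (-1)) hm (k + d + 1))).toTopRep,
        oneCocycleClass _ φq =
          DiscreteGaloisModule.quotientMap (GaloisRep.toLocal v ((κ.unitTwist (-1)).eisensteinTwist
              ((W.baseChange K).torsionGaloisModule ((p : ℤ) ^ (k + d + 1))) hm (k + d + 1)))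
            (((W.baseChange K).ordinaryFiltrationAt v (fun i ↦ (W.baseChange K).torsionGaloisModuleReduce p i)
              (fun _ _ ↦ rfl)).twistedFil (k + d + 1))
            (((W.baseChange K).ordinaryFiltrationAt v (fun i ↦ (W.baseChange K).torsionGaloisModuleReduce p i)
              (fun _ _ ↦ rfl)).twistedFil_le_comap (κ := κ.unitTwist (-1)) hm (k + d + 1)) 1
            (AdicTower.incLocIter (W.eisensteinTower (κ.unitTwist (-1)) hm) π e hkill hker hπ he k (Sum.inr v) d
              (galoisCohomology.localization
                ((κ.unitTwist (-1)).eisensteinTwist ((W.baseChange K).torsionGaloisModule ((p : ℤ) ^ (k + 1))) hm (k + 1))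
                (Sum.inr v) 1 c)) ∧
        ∃ q₀ : Twisted p m (k + d + 1) (geomTorsion (W.baseChange K) ((p : ℤ) ^ (k + d + 1))) ⧸
            ((W.baseChange K).ordinaryFiltrationAt v (fun i ↦ (W.baseChange K).torsionGaloisModuleReduce p i)
              (fun _ _ ↦ rfl)).twistedFil (k + d + 1),
          ∀ σ : absoluteGaloisGroup (v.adicCompletion K), absGaloisRestrict K (v.adicCompletion K) σ ∈ κ.kerSubgroup →
            φq.1 σ = (GaloisRep.toLocal v ((κ.unitTwist (-1)).eisensteinTwist
                ((W.baseChange K).torsionGaloisModule ((p : ℤ) ^ (k + d + 1))) hm (k + d + 1))).quotient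
                (((W.baseChange K).ordinaryFiltrationAt v (fun i ↦ (W.baseChange K).torsionGaloisModuleReduce p i)
                  (fun _ _ ↦ rfl)).twistedFil (k + d + 1))
                (((W.baseChange K).ordinaryFiltrationAt v (fun i ↦ (W.baseChange K).torsionGaloisModuleReduce p i)
                  (fun _ _ ↦ rfl)).twistedFil_le_comap (κ := κ.unitTwist (-1)) hm (k + d + 1)) σ q₀ - q₀ := by
  letI := IwasawaAlgebra.isLocalRing_quotient_X_pow_add_C p hm
  obtain ⟨d, hd⟩ := (W.baseChange K).exists_shift_coboundary_mod_kernelOfReduction κ v hgood hpv hord'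
  refine ⟨d, fun k c hc ↦ ?_⟩
  have hsurj := oneCocycleClass_surjective
    ((κ.unitTwist (-1)).eisensteinTwist ((W.baseChange K).torsionGaloisModule ((p : ℤ) ^ (k + 1))) hm (k + 1)).toTopRep c
  rcases hsurj with ⟨ξ, hξ⟩
  rw [← hξ] at hc
  have hlast : m - 1 < m := Nat.sub_lt (lt_of_lt_of_le zero_lt_one hm) zero_lt_one
  have hcoord := (κ.unitTwist (-1)).exists_coordCocycles hm (k + 1)
    ((κ.unitTwist (-1)).eisensteinTwistChar hm (k + 1)) ((W.baseChange K).torsionGaloisModule ((p : ℤ) ^ (k + 1)))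
    (fun σ y ↦ (κ.unitTwist (-1)).eisensteinTwist_torsionGaloisModule_apply hm (k + 1) (W.baseChange K) _ σ y) κ
    (fun b ↦ (W.baseChange K).geomTorsion_pow_nsmul_eq_zero p (k + 1) b)
    (fun _ hσ ↦ κ.eisensteinTwistChar_unitTwist_eq_one_of_mem_kerSubgroup hm (k + 1) (-1) hσ) ξ
  rcases hcoord with ⟨φ, hφ⟩
  -- (1) the readout of `[ξ]` is `(-1)^k • ι_* [φ_{m-1}]`
  have hread : W.eisensteinTowerReadout κ hm π e hkill hker hπ he hπX hek
      (AddCommGroup.DirectLimit.of _ _ k (oneCocycleClass ((κ.unitTwist (-1)).eisensteinTwist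
        ((W.baseChange K).torsionGaloisModule ((p : ℤ) ^ (k + 1))) hm (k + 1)).toTopRep ξ :
          galoisCohomology ((κ.unitTwist (-1)).eisensteinTwist
            ((W.baseChange K).torsionGaloisModule ((p : ℤ) ^ (k + 1))) hm (k + 1)) 1) :
        AdicTower.H1A (W.eisensteinTower (κ.unitTwist (-1)) hm) π e hkill hker hπ he) =
      ((-1 : ℤ) ^ k) • resH1Hom (ContinuousMonoidHom.id κ.kerSubgroup)
        (AddSubgroup.inclusion (AcSigned.geomTorsion_zpow_le_geomPrimaryTorsion (W.baseChange K) p (k + 1)))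
        (fun _ _ ↦ rfl) (oneCocycleClass _ (φ ⟨m - 1, hlast⟩)) := by
    rw [WeierstrassCurve.eisensteinTowerReadout, ZpExtension.eisensteinTowerReadout_of,
      ZpExtension.eisensteinTowerLevelMap_apply,
      (κ.unitTwist (-1)).eisensteinTwistLevelReadout_oneCocycleClass hm (k + 1) _ _ _ κ _ _ ξ φ hφ]
  -- (2) every coordinate class lies in `ι_*⁻¹ Sel_∞` (shift relations; `Sel_∞` is `conj_γ`-stable)
  have h𝒮M : ∀ s ∈ ((W.baseChange K).selmerInfty κ).comap (resH1Hom (ContinuousMonoidHom.id κ.kerSubgroup)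
      (AddSubgroup.inclusion (AcSigned.geomTorsion_zpow_le_geomPrimaryTorsion (W.baseChange K) p (k + 1))) (fun _ _ ↦ rfl)),
      Literature.NumberTheory.EllipticCurves.conjH1 κ.kerSubgroup (geomTorsion (W.baseChange K) ((p : ℤ) ^ (k + 1))) γ s ∈
        ((W.baseChange K).selmerInfty κ).comap (resH1Hom (ContinuousMonoidHom.id κ.kerSubgroup)
          (AddSubgroup.inclusion (AcSigned.geomTorsion_zpow_le_geomPrimaryTorsion (W.baseChange K) p (k + 1))) (fun _ _ ↦ rfl)) := by
    intro s hs
    rw [AddSubgroup.mem_comap] at hs ⊢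
    rw [W.resH1Hom_inclusion_conjH1 κ γ (k + 1)]
    exact (W.baseChange K).map_conjH1_selmerGroupOver_le_holds p κ.kerSubgroup γ ⟨_, hs, rfl⟩
  have hlastmem : oneCocycleClass _ (φ ⟨m - 1, hlast⟩) ∈ ((W.baseChange K).selmerInfty κ).comap
      (resH1Hom (ContinuousMonoidHom.id κ.kerSubgroup)
        (AddSubgroup.inclusion (AcSigned.geomTorsion_zpow_le_geomPrimaryTorsion (W.baseChange K) p (k + 1))) (fun _ _ ↦ rfl)) := by
    rw [AddSubgroup.mem_comap]
    have h2 := ((W.baseChange K).selmerInfty κ).zsmul_mem hc ((-1 : ℤ) ^ k)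
    rw [hread, smul_smul, ← mul_pow, neg_mul_neg, one_mul, one_pow, one_smul] at h2
    exact h2
  have hall := fun j : Fin m ↦ (κ.unitTwist (-1)).oneCocycleClass_coord_mem_of_last_mem hm (k + 1)
    ((κ.unitTwist (-1)).eisensteinTwistChar hm (k + 1)) ((W.baseChange K).torsionGaloisModule ((p : ℤ) ^ (k + 1)))
    (fun σ y ↦ (κ.unitTwist (-1)).eisensteinTwist_torsionGaloisModule_apply hm (k + 1) (W.baseChange K) _ σ y) κ
    (fun b ↦ (W.baseChange K).geomTorsion_pow_nsmul_eq_zero p (k + 1) b)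
    (fun _ hσ ↦ κ.eisensteinTwistChar_unitTwist_eq_one_of_mem_kerSubgroup hm (k + 1) (-1) hσ)
    (κ.eisensteinTwistChar_unitTwist_neg_one_mul_onePlusT hm (k + 1) hγ) ξ φ hφ _ h𝒮M hlastmem j
  -- (3) hence in the local condition at `v`, hence coboundaries modulo `C_v` on `ker κ ⊓ D_v`
  have hloc : ∀ j : Fin m, resH1Hom (ContinuousMonoidHom.id κ.kerSubgroup)
      (AddSubgroup.inclusion (AcSigned.geomTorsion_zpow_le_geomPrimaryTorsion (W.baseChange K) p (k + 1))) (fun _ _ ↦ rfl)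
      (oneCocycleClass _ (φ j)) ∈ (W.baseChange K).localKerOver p κ.kerSubgroup (v.adicCompletion K) := by
    intro j
    have h0 : resH1Hom (ContinuousMonoidHom.id κ.kerSubgroup)
        (AddSubgroup.inclusion (AcSigned.geomTorsion_zpow_le_geomPrimaryTorsion (W.baseChange K) p (k + 1)))
        (fun _ _ ↦ rfl) (oneCocycleClass _ (φ j)) ∈ (W.baseChange K).selmerGroupOver p κ.kerSubgroup :=
      AddSubgroup.mem_comap.1 (hall j)
    have h1 := (((W.baseChange K).mem_selmerGroupOver_iff p κ.kerSubgroup _).1 h0).1 v 1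
    rwa [(W.baseChange K).conjH1_one_holds p κ.kerSubgroup, AddMonoidHom.id_apply] at h1
  have hq : ∀ j : Fin m, ∃ q : ((W.baseChange K).kernelOfReductionLocalDatum p v).Gr, ∀ y : decompIn κ.kerSubgroup v,
      ((W.baseChange K).kernelOfReductionLocalDatum p v).grMk (AddSubgroup.inclusion (AcSigned.geomTorsion_zpow_le_geomPrimaryTorsion (W.baseChange K) p (k + 1))
        ((φ j).1 (decompInToH κ.kerSubgroup v y))) = y • q - q := fun j ↦
    (W.baseChange K).exists_grMk_eq_coboundary_of_mem_localKerOver κ v hpv hgood hord hram hCG (φ j) (hloc j)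
  choose q hq using hq
  -- (4) shift the `q_j` into `E[p^{k+1+d}]` (Part 1)
  have hshift := fun j ↦ hd (k + 1) (fun y ↦ (φ j).1 (decompInToH κ.kerSubgroup v y)) (q j) (hq j)
  choose qhat hqhat using hshift
  -- (5) an explicit cocycle of `incLocIter … d (loc_v c)` and its quotient modulo `Fil_v`
  have hcoc := W.exists_cocycle_incLocIter_localization κ hm π e hkill hker hπ he hπX hek v k ξ φ hφ d
  rcases hcoc with ⟨η, hη, hηval⟩
  refine ⟨contOneCocycles.pullback (ContinuousMonoidHom.id _)
    (X := (GaloisRep.toLocal v ((κ.unitTwist (-1)).eisensteinTwist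
        ((W.baseChange K).torsionGaloisModule ((p : ℤ) ^ (k + d + 1))) hm (k + d + 1))).toTopRep)
    (Y := ((GaloisRep.toLocal v ((κ.unitTwist (-1)).eisensteinTwist
        ((W.baseChange K).torsionGaloisModule ((p : ℤ) ^ (k + d + 1))) hm (k + d + 1))).quotient (((W.baseChange K).ordinaryFiltrationAt v (fun i ↦ (W.baseChange K).torsionGaloisModuleReduce p i) (fun _ _ ↦ rfl)).twistedFil (k + d + 1))
        (((W.baseChange K).ordinaryFiltrationAt v (fun i ↦ (W.baseChange K).torsionGaloisModuleReduce p i) (fun _ _ ↦ rfl)).twistedFil_le_comap (κ := κ.unitTwist (-1)) hm (k + d + 1))).toTopRep)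
    (TopRep.ofHom ⟨⟨(((W.baseChange K).ordinaryFiltrationAt v (fun i ↦ (W.baseChange K).torsionGaloisModuleReduce p i) (fun _ _ ↦ rfl)).twistedFil (k + d + 1)).mkQ.toAddMonoidHom.toIntLinearMap, continuous_of_discreteTopology⟩,
      fun g => ContinuousLinearMap.ext fun x => rfl⟩) η, ?_, ?_⟩
  · rw [hξ] at hη
    rw [← hη]
    exact (map_oneCocycleClass _ _ _ η).symm
  have hle : k + 1 + d ≤ k + d + 1 := by omega
  let qh : Fin m → geomTorsion (W.baseChange K) ((p : ℤ) ^ (k + d + 1)) := fun j ↦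
    AddSubgroup.inclusion (geomTorsion_le_of_dvd (W.baseChange K) (pow_dvd_pow (p : ℤ) hle)) (qhat j)
  refine ⟨(((W.baseChange K).ordinaryFiltrationAt v (fun i ↦ (W.baseChange K).torsionGaloisModuleReduce p i) (fun _ _ ↦ rfl)).twistedFil (k + d + 1)).mkQ (((-1 : ℤ) ^ d) • ∑ i : Fin m, Twisted.tmul
      (Ideal.Quotient.mk _ ((PowerSeries.X : IwasawaAlgebra p) ^ (i : ℕ)) : EisensteinCoeff p m (k + d + 1)) (qh i)),
    fun σ hσ ↦ ?_⟩
  let y : decompIn κ.kerSubgroup v :=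
    ⟨⟨absGaloisRestrict K (v.adicCompletion K) σ, (mem_decomp_iff v _).2 ⟨σ, rfl⟩⟩,
      (mem_decompIn_iff κ.kerSubgroup v _).2 hσ⟩
  have hyH : decompInToH κ.kerSubgroup v y = ⟨absGaloisRestrict K (v.adicCompletion K) σ, hσ⟩ := rfl
  have htw : ∀ (c' : EisensteinCoeff p m (k + d + 1)) (a : geomTorsion (W.baseChange K) ((p : ℤ) ^ (k + d + 1))),
      GaloisRep.toLocal v ((κ.unitTwist (-1)).eisensteinTwist ((W.baseChange K).torsionGaloisModule ((p : ℤ) ^ (k + d + 1))) hm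
        (k + d + 1)) σ (Twisted.tmul c' a) = Twisted.tmul c' (absGaloisRestrict K (v.adicCompletion K) σ • a) := by
    intro c' a
    rw [GaloisRep.toLocal_apply, ZpExtension.eisensteinTwist_apply_eq_smul_mapEnd,
      κ.eisensteinTwistChar_unitTwist_eq_one_of_mem_kerSubgroup hm (k + d + 1) (-1) hσ, one_smul,
      CoeffExtension.mapEnd_tmul]
    rfl
  -- each coordinate difference lies in `Fil_v E[p^{k+d+1}]`
  have hfil : ∀ j : Fin m,
      AddSubgroup.inclusion (geomTorsion_le_of_dvd (W.baseChange K) (pow_dvd_pow (p : ℤ) (Nat.add_le_add_right (Nat.le_add_right k d) 1)))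
          ((φ j).1 ⟨absGaloisRestrict K (v.adicCompletion K) σ, hσ⟩) -
        (absGaloisRestrict K (v.adicCompletion K) σ • qh j - qh j) ∈ ((W.baseChange K).ordinaryFiltrationAt v (fun i ↦ (W.baseChange K).torsionGaloisModuleReduce p i) (fun _ _ ↦ rfl)).fil (k + d + 1) := by
    intro j
    have h1 := hqhat j y
    rw [hyH, mem_kernelOfReductionLocalDatum_plus_iff] at h1
    rw [ordinaryFiltrationAt_fil, mem_torsionFilAt_iff]
    exact h1
  -- conclude: `η σ - (σ w₀ - w₀) ∈ Fil_v W_{k+d+1}`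
  rw [contOneCocycles.pullback_apply]
  change (((W.baseChange K).ordinaryFiltrationAt v (fun i ↦ (W.baseChange K).torsionGaloisModuleReduce p i)
      (fun _ _ ↦ rfl)).twistedFil (k + d + 1)).mkQ
      (η.1 σ : Twisted p m (k + d + 1) (geomTorsion (W.baseChange K) ((p : ℤ) ^ (k + d + 1)))) =
    (((W.baseChange K).ordinaryFiltrationAt v (fun i ↦ (W.baseChange K).torsionGaloisModuleReduce p i)
      (fun _ _ ↦ rfl)).twistedFil (k + d + 1)).mkQ (GaloisRep.toLocal v ((κ.unitTwist (-1)).eisensteinTwist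
      ((W.baseChange K).torsionGaloisModule ((p : ℤ) ^ (k + d + 1))) hm (k + d + 1)) σ _) -
      (((W.baseChange K).ordinaryFiltrationAt v (fun i ↦ (W.baseChange K).torsionGaloisModuleReduce p i)
        (fun _ _ ↦ rfl)).twistedFil (k + d + 1)).mkQ _
  rw [← map_sub, ← sub_eq_zero, ← map_sub, Submodule.mkQ_apply, Submodule.Quotient.mk_eq_zero, hηval σ hσ, map_zsmul,
    map_sum]
  simp_rw [htw]
  rw [← smul_sub, ← smul_sub, ← Finset.sum_sub_distrib, ← Finset.sum_sub_distrib]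
  simp_rw [← Twisted.tmul_sub]
  exact Submodule.smul_mem _ _ (Submodule.sum_mem _ fun j _ ↦
    ((W.baseChange K).ordinaryFiltrationAt v (fun i ↦ (W.baseChange K).torsionGaloisModuleReduce p i)
      (fun _ _ ↦ rfl)).tmul_mem_twistedFil (k + d + 1) _ (hfil j))

end WeierstrassCurve

end
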